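import Mathlib
import HarnessLib
import Literature.MathematicalPhysics.QuantumLattice.HubbardBandSectorCountingBounds
import Summits.HubbardSuperconductivity.HubbardSuperconductivity.Theorems.KLProgrammeFermiSurfaceEnvelope
import Summits.HubbardSuperconductivity.HubbardSuperconductivity.Theorems.KLProgrammeFermiSurfaceBandConstants
import Summits.HubbardSuperconductivity.HubbardSuperconductivity.Theorems.KLProgrammeFermiSurfaceSharpTrig
/-!
# Route `KLProgramme` (K1 `H10TwoPointLimit`, K3 `KLRegimeTwoPointLimit`) — sharp band-curve envelopes, part 2:
# radius, speed, normal coefficient and radial transversality on one level curve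

Cell `gate-hubbard-kl`, seat fs-1 (g4), risk r2 (serving r1). Every consumer of the free curve in the sector-counting
toolbox (`count_pairs_exists`, p4's relative / offset / perturbed counts, p1b's two-shell bounds `kltb_*`) carries the
geometry ONLY through the eight fields of the `[tree]` structure `BandSectorCounting.BandBounds a b`. The tree's generic
construction `bandBounds a b` is valid on every `[a, b] ⊂ (-4, 0)` but near the van Hove level it is three to four
orders of magnitude off the truth (FS-WINDOW.md §3: on the certified window `a_min = 3.8·10⁻⁴` vs the true `0.0687`,
`C_g = 5.2·10⁴`; p1b E1-NOTE §8.5). This file proves, at a level `-4 < μ < 0` and every angle `θ`, the SHARP pointwise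
envelopes of the first-order quantities. Notation: `m = -μ/2`, `d_μ = arccos(-μ/4)` (nodal coordinate, `cos d = m/2`),
`K_μ = umklappRadius μ = arccos(-μ/2 - 1)` (antinodal coordinate), `s_μ = √(-μ(4+μ))/2 = sin K_μ`,
`u = bandFermiRadius`, `(x, y) = (bandX, bandY)`, `' = d/dθ`, `c = bandNormalCoeff` (so `x sin x + y sin y = c u²`),
`ρ = √(sin² x + sin² y) = |∇ε|/2`.

* `|x| + |y| < π` (the curve lies inside the half-filling diamond), `u < π`;
* **`√2·d_μ ≤ u ≤ K_μ`** — both ends attained (node / antinode); Jensen / Karamata for the convex `a ↦ cos √a`;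
* **`|u'| ≤ u`** (`u'² ≤ u²`, from part 1's core inequality), hence `x'² + y'² ≤ 2u²`, `|x'|, |y'| ≤ √2 u`,
  `ρ ≤ √2 · c u`, **`∂_t F(θ, u) ≥ √2 ρ ≥ √2 s_μ`**;
* **`sin K_μ / K_μ ≤ c ≤ sin d_μ / d_μ`** — both ends attained (antinode / node); the upper end is part 1's
  tangent-line inequality.

Second-order quantities (`H`, `x''`, `y''`, `α'`) are in part 3 `KLProgrammeFermiSurfaceSharpCurvature.lean`; the
closed-form RANGE bundle and the window numbers in `KLProgrammeFermiSurfaceSharpBandBounds.lean`; certified numerics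
(kit job j252652, two interval implementations, branch-and-bound truth columns) in FS-WINDOW.md §6.
No definitions; everything PROVED. [folklore]
-/

noncomputable section

open Real Set

-- the tree's namespace `Summit.<Summit>.<Problem>.Theorems` repeats the summit name by design (D-0017)
set_option linter.dupNamespace false

namespace Summit.HubbardSuperconductivity.HubbardSuperconductivity.Theorems

open Literature.MathematicalPhysics.QuantumLattice
open Literature.MathematicalPhysics.QuantumLattice.BandSectorCounting

/-! ### §1 Sharp pointwise envelopes on one level curve -/

section Level

variable {μ : ℝ} (hμ₁ : -4 < μ) (hμ₂ : μ < 0)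
include hμ₁ hμ₂

/-- `cos x + cos y = -μ/2` along the band curve. [folklore] -/
theorem klfs_cos_bandX_add_cos_bandY (θ : ℝ) :
    Real.cos (bandX μ θ) + Real.cos (bandY μ θ) = -μ / 2 := by
  have h := sqDispersion_bandXY hμ₁ hμ₂ θ; linarith

/-- `x sin x + y sin y = c u²` (`c = bandNormalCoeff = ∂_tF/(2u)`, `u ∂_tF = 2 (x sin x + y sin y)`). [folklore] -/
theorem klfs_W_eq (θ : ℝ) :
    bandX μ θ * Real.sin (bandX μ θ) + bandY μ θ * Real.sin (bandY μ θ) =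
      bandNormalCoeff μ θ * bandFermiRadius μ θ ^ 2 := by
  have hu := bandFermiRadius_pos hμ₁ hμ₂ θ
  have hid : bandFermiRadius μ θ * rayDispersionDt θ (bandFermiRadius μ θ) =
      2 * (bandX μ θ * Real.sin (bandX μ θ) + bandY μ θ * Real.sin (bandY μ θ)) := by
    simp only [rayDispersionDt, bandX, bandY]; ring
  rw [bandNormalCoeff]
  field_simp
  nlinarith [hid]

/-- `∂_t F(θ, u) = 2 u c`. [folklore] -/
theorem klfs_rayDispersionDt_eq (θ : ℝ) :
    rayDispersionDt θ (bandFermiRadius μ θ) = 2 * bandFermiRadius μ θ * bandNormalCoeff μ θ := by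
  have hu := bandFermiRadius_pos hμ₁ hμ₂ θ
  rw [bandNormalCoeff]; field_simp

/-- **`|x| + |y| < π` on the band curve** (the curve lies strictly inside the half-filling diamond): if
`|x| + |y| ≥ π` then `cos x ≤ cos(π - |y|) = -cos y`, contradicting `cos x + cos y = -μ/2 > 0`. [folklore] -/
theorem klfs_abs_bandX_add_abs_bandY_lt_pi (θ : ℝ) : |bandX μ θ| + |bandY μ θ| < π := by
  by_contra hcon
  rw [not_lt] at hcon
  have hx := abs_bandX_lt_pi hμ₁ hμ₂ θ
  have hy := abs_bandY_lt_pi hμ₁ hμ₂ θ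
  have hlev := klfs_cos_bandX_add_cos_bandY hμ₁ hμ₂ θ
  have h1 : Real.cos |bandX μ θ| ≤ Real.cos (π - |bandY μ θ|) :=
    Real.cos_le_cos_of_nonneg_of_le_pi (by linarith [abs_nonneg (bandY μ θ)]) hx.le (by linarith)
  rw [Real.cos_abs, Real.cos_pi_sub, Real.cos_abs] at h1
  linarith

/-- `u² ≤ (|x| + |y|)² < π²`, in particular **`u < π`**. [folklore] -/
theorem klfs_bandFermiRadius_lt_pi (θ : ℝ) : bandFermiRadius μ θ < π := by
  have hu := bandFermiRadius_pos hμ₁ hμ₂ θ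
  have hsq := bandFermiRadius_sq (μ := μ) θ
  have h := klfs_abs_bandX_add_abs_bandY_lt_pi hμ₁ hμ₂ θ
  have h2 : bandFermiRadius μ θ ^ 2 ≤ (|bandX μ θ| + |bandY μ θ|) ^ 2 := by
    rw [hsq]; nlinarith [abs_nonneg (bandX μ θ), abs_nonneg (bandY μ θ), sq_abs (bandX μ θ), sq_abs (bandY μ θ)]
  have h3 : 0 ≤ |bandX μ θ| + |bandY μ θ| := by positivity
  nlinarith [Real.pi_pos]

/-- **Upper radius envelope `u ≤ K_μ = arccos(-μ/2 - 1)`** on the whole hole-doped band (attained at the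
antinodes): Karamata `cos x + cos y ≤ 1 + cos u`, so `cos u ≥ -μ/2 - 1 = cos K_μ`. (`BGM2006Sec2Lemma21Proof`
has the Euclidean-radius bound for sublevel sets at `μ < -2`; here every `-4 < μ < 0`.) [folklore] -/
theorem klfs_bandFermiRadius_le_umklappRadius (θ : ℝ) : bandFermiRadius μ θ ≤ umklappRadius μ := by
  have hu := bandFermiRadius_pos hμ₁ hμ₂ θ
  have huπ := klfs_bandFermiRadius_lt_pi hμ₁ hμ₂ θ
  have hsq := bandFermiRadius_sq (μ := μ) θ
  have hlev := klfs_cos_bandX_add_cos_bandY hμ₁ hμ₂ θ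
  have hk : bandX μ θ ^ 2 + bandY μ θ ^ 2 ≤ π ^ 2 := by rw [← hsq]; nlinarith [Real.pi_pos]
  have h := klfs_cos_add_cos_le_one_add_cos_sqrt hk
  rw [← hsq, Real.sqrt_sq hu.le, hlev] at h
  have hcos : Real.cos (umklappRadius μ) ≤ Real.cos (bandFermiRadius μ θ) := by
    rw [umklappRadius, Real.cos_arccos (by linarith) (by linarith)]; linarith
  rw [← Real.arccos_cos hu.le huπ.le, umklappRadius, ← Real.cos_arccos (x := -μ / 2 - 1) (by linarith) (by linarith)]
  rw [umklappRadius] at hcos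
  exact Real.antitone_arccos hcos |>.trans_eq (by rw [Real.arccos_cos (Real.arccos_nonneg _) (Real.arccos_le_pi _)])

/-- **Lower radius envelope `√2 · d_μ ≤ u`, `d_μ = arccos(-μ/4)`** (attained at the nodes `x = y = d_μ`):
two-point Jensen `2 cos(u/√2) ≤ cos x + cos y = -μ/2 = 2 cos d_μ`. [folklore] -/
theorem klfs_sqrt_two_mul_arccos_le_bandFermiRadius (θ : ℝ) :
    Real.sqrt 2 * Real.arccos (-μ / 4) ≤ bandFermiRadius μ θ := by
  have hu := bandFermiRadius_pos hμ₁ hμ₂ θ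
  have huπ := klfs_bandFermiRadius_lt_pi hμ₁ hμ₂ θ
  have hsq := bandFermiRadius_sq (μ := μ) θ
  have hlev := klfs_cos_bandX_add_cos_bandY hμ₁ hμ₂ θ
  have h := klfs_two_mul_cos_sqrt_le (abs_bandX_lt_pi hμ₁ hμ₂ θ).le (abs_bandY_lt_pi hμ₁ hμ₂ θ).le
  rw [← hsq, hlev] at h
  have h2 : 0 < Real.sqrt 2 := Real.sqrt_pos.2 (by norm_num)
  have hs : Real.sqrt (bandFermiRadius μ θ ^ 2 / 2) = bandFermiRadius μ θ / Real.sqrt 2 := by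
    rw [Real.sqrt_div (sq_nonneg _), Real.sqrt_sq hu.le]
  rw [hs] at h
  have hcos : Real.cos (bandFermiRadius μ θ / Real.sqrt 2) ≤ -μ / 4 := by linarith
  have hr0 : 0 ≤ bandFermiRadius μ θ / Real.sqrt 2 := div_nonneg hu.le h2.le
  have hrπ : bandFermiRadius μ θ / Real.sqrt 2 ≤ π := by
    rw [div_le_iff₀ h2]
    have h1 : (1 : ℝ) ≤ Real.sqrt 2 := by
      rw [show (1 : ℝ) = Real.sqrt 1 by simp]; exact Real.sqrt_le_sqrt (by norm_num)
    nlinarith [Real.pi_pos]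
  have h3 := Real.antitone_arccos hcos
  rw [Real.arccos_cos hr0 hrπ] at h3
  calc Real.sqrt 2 * Real.arccos (-μ / 4) ≤ Real.sqrt 2 * (bandFermiRadius μ θ / Real.sqrt 2) :=
        mul_le_mul_of_nonneg_left h3 h2.le
    _ = bandFermiRadius μ θ := by field_simp

/-- **`2 c² u² ≥ sin² x + sin² y`** (`W = c u²`, `2W² ≥ u²S`): the angle between the gradient and the radius
vector is at most `π/4` everywhere on every level curve of the hole-doped band. [folklore] -/
theorem klfs_sin_sq_add_le_two_mul_coeff_sq (θ : ℝ) :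
    Real.sin (bandX μ θ) ^ 2 + Real.sin (bandY μ θ) ^ 2 ≤
      2 * (bandNormalCoeff μ θ ^ 2 * bandFermiRadius μ θ ^ 2) := by
  have hu := bandFermiRadius_pos hμ₁ hμ₂ θ
  have hsq := bandFermiRadius_sq (μ := μ) θ
  have hW := klfs_W_eq hμ₁ hμ₂ θ
  have hcore := klfs_sq_mul_sin_sq_le (klfs_abs_bandX_add_abs_bandY_lt_pi hμ₁ hμ₂ θ).le
  rw [← hsq, hW] at hcore
  have hu2 : 0 < bandFermiRadius μ θ ^ 2 := by positivity
  have : bandFermiRadius μ θ ^ 2 * (Real.sin (bandX μ θ) ^ 2 + Real.sin (bandY μ θ) ^ 2) ≤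
      bandFermiRadius μ θ ^ 2 * (2 * (bandNormalCoeff μ θ ^ 2 * bandFermiRadius μ θ ^ 2)) := by
    nlinarith [hcore]
  exact le_of_mul_le_mul_left this hu2

/-- **`|u'| ≤ u`: the polar radius of the band curve never changes faster than itself** (`u'² ≤ u²`;
equivalently `cos ∠(∇ε, p) ≥ 1/√2`). From `S = c² (u'² + u²)` (`rho_sq_eq`) and `S ≤ 2 c² u²`. [folklore] -/
theorem klfs_radiusDeriv_sq_le (θ : ℝ) : bandFermiRadiusDeriv μ θ ^ 2 ≤ bandFermiRadius μ θ ^ 2 := by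
  have h := klfs_sin_sq_add_le_two_mul_coeff_sq hμ₁ hμ₂ θ
  rw [rho_sq_eq hμ₁ hμ₂ θ] at h
  have hc := bandNormalCoeff_pos hμ₁ hμ₂ θ
  have hc2 : 0 < bandNormalCoeff μ θ ^ 2 := by positivity
  nlinarith [hc2]

/-- `|u'| ≤ u`. [folklore] -/
theorem klfs_abs_radiusDeriv_le (θ : ℝ) : |bandFermiRadiusDeriv μ θ| ≤ bandFermiRadius μ θ :=
  abs_le_of_sq_le_sq (klfs_radiusDeriv_sq_le hμ₁ hμ₂ θ) (bandFermiRadius_pos hμ₁ hμ₂ θ).le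

/-- **Speed envelope `x'² + y'² ≤ 2u²`** (`x'² + y'² = u'² + u²`). [folklore] -/
theorem klfs_speed_sq_le (θ : ℝ) : bandVX μ θ ^ 2 + bandVY μ θ ^ 2 ≤ 2 * bandFermiRadius μ θ ^ 2 := by
  rw [bandVX_sq_add_bandVY_sq]; linarith [klfs_radiusDeriv_sq_le hμ₁ hμ₂ θ]

/-- `|x'| ≤ √2 u`. [folklore] -/
theorem klfs_abs_bandVX_le (θ : ℝ) : |bandVX μ θ| ≤ Real.sqrt 2 * bandFermiRadius μ θ := by
  have hu := bandFermiRadius_pos hμ₁ hμ₂ θ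
  have h := klfs_speed_sq_le hμ₁ hμ₂ θ
  refine abs_le_of_sq_le_sq ?_ (by positivity)
  rw [mul_pow, Real.sq_sqrt (by norm_num : (0:ℝ) ≤ 2)]; nlinarith [sq_nonneg (bandVY μ θ)]

/-- `|y'| ≤ √2 u`. [folklore] -/
theorem klfs_abs_bandVY_le (θ : ℝ) : |bandVY μ θ| ≤ Real.sqrt 2 * bandFermiRadius μ θ := by
  have hu := bandFermiRadius_pos hμ₁ hμ₂ θ
  have h := klfs_speed_sq_le hμ₁ hμ₂ θ
  refine abs_le_of_sq_le_sq ?_ (by positivity)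
  rw [mul_pow, Real.sq_sqrt (by norm_num : (0:ℝ) ≤ 2)]; nlinarith [sq_nonneg (bandVX μ θ)]

/-- **`c u ≥ ρ/√2`**, written as `ρ ≤ √2 · (c u)` with `ρ = √(sin² x + sin² y)`. [folklore] -/
theorem klfs_rho_le_sqrt_two_mul_coeff_mul_radius (θ : ℝ) :
    Real.sqrt (Real.sin (bandX μ θ) ^ 2 + Real.sin (bandY μ θ) ^ 2) ≤
      Real.sqrt 2 * (bandNormalCoeff μ θ * bandFermiRadius μ θ) := by
  have hc := bandNormalCoeff_pos hμ₁ hμ₂ θ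
  have hu := bandFermiRadius_pos hμ₁ hμ₂ θ
  have h := klfs_sin_sq_add_le_two_mul_coeff_sq hμ₁ hμ₂ θ
  rw [show Real.sqrt 2 * (bandNormalCoeff μ θ * bandFermiRadius μ θ) =
    Real.sqrt (2 * (bandNormalCoeff μ θ ^ 2 * bandFermiRadius μ θ ^ 2)) by
      rw [Real.sqrt_mul' 2 (by positivity), show bandNormalCoeff μ θ ^ 2 * bandFermiRadius μ θ ^ 2 =
        (bandNormalCoeff μ θ * bandFermiRadius μ θ) ^ 2 by ring, Real.sqrt_sq (by positivity)]]
  exact Real.sqrt_le_sqrt h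

/-- **Radial transversality from below: `∂_t F(θ, u) ≥ √2 ρ ≥ √2 s_μ`** (`∂_t F = 2uc`). [folklore] -/
theorem klfs_rayDispersionDt_ge_sqrt_two_mul_rho (θ : ℝ) :
    Real.sqrt 2 * Real.sqrt (Real.sin (bandX μ θ) ^ 2 + Real.sin (bandY μ θ) ^ 2) ≤
      rayDispersionDt θ (bandFermiRadius μ θ) := by
  have h := klfs_rho_le_sqrt_two_mul_coeff_mul_radius hμ₁ hμ₂ θ
  have h2 : 0 < Real.sqrt 2 := Real.sqrt_pos.2 (by norm_num)
  have h22 : Real.sqrt 2 * Real.sqrt 2 = 2 := Real.mul_self_sqrt (by norm_num)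
  rw [klfs_rayDispersionDt_eq hμ₁ hμ₂ θ]
  calc Real.sqrt 2 * Real.sqrt (Real.sin (bandX μ θ) ^ 2 + Real.sin (bandY μ θ) ^ 2)
      ≤ Real.sqrt 2 * (Real.sqrt 2 * (bandNormalCoeff μ θ * bandFermiRadius μ θ)) := mul_le_mul_of_nonneg_left h h2.le
    _ = 2 * bandFermiRadius μ θ * bandNormalCoeff μ θ := by rw [← mul_assoc, h22]; ring

/-- **Gradient envelope `ρ ≥ s_μ = √(-μ(4+μ))/2`** (`= sin K_μ`, attained at the antinodes; `KLProgrammeFermiSurfaceEnvelope`). [folklore] -/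
theorem klfs_levelSin_le_rho (θ : ℝ) :
    Real.sqrt (-μ * (4 + μ)) / 2 ≤ Real.sqrt (Real.sin (bandX μ θ) ^ 2 + Real.sin (bandY μ θ) ^ 2) := by
  have h := (klfs_polarFermiSpeedSq_mem_Icc hμ₁ hμ₂ θ).1
  have h2 : Real.sqrt (-μ * (4 + μ)) ≤ Real.sqrt (4 * (Real.sin (bandX μ θ) ^ 2 + Real.sin (bandY μ θ) ^ 2)) :=
    Real.sqrt_le_sqrt h
  rw [← klfs_two_mul_sqrt] at h2
  linarith

/-- **`c ≤ sin d_μ / d_μ`**, `d_μ = arccos(-μ/4)` — the normal coefficient is largest at the nodes, where it equals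
`sinc d_μ`. The tangent-line inequality with `cos x + cos y = 2 cos d_μ`. [folklore] -/
theorem klfs_bandNormalCoeff_le_sinc (θ : ℝ) :
    bandNormalCoeff μ θ ≤ Real.sin (Real.arccos (-μ / 4)) / Real.arccos (-μ / 4) := by
  have hu := bandFermiRadius_pos hμ₁ hμ₂ θ
  have hd0 : 0 < Real.arccos (-μ / 4) := Real.arccos_pos.2 (by linarith)
  have hdπ : Real.arccos (-μ / 4) < π := by
    have := Real.arccos_lt_pi_div_two.2 (show 0 < -μ / 4 by linarith); linarith [Real.pi_pos]
  have hlev : Real.cos (bandX μ θ) + Real.cos (bandY μ θ) = 2 * Real.cos (Real.arccos (-μ / 4)) := by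
    rw [Real.cos_arccos (by linarith) (by linarith), klfs_cos_bandX_add_cos_bandY hμ₁ hμ₂ θ]; ring
  have h := klfs_mul_sin_add_le_sinc_mul hd0 hdπ (abs_bandX_lt_pi hμ₁ hμ₂ θ).le (abs_bandY_lt_pi hμ₁ hμ₂ θ).le hlev
  rw [klfs_W_eq hμ₁ hμ₂ θ, ← bandFermiRadius_sq (μ := μ) θ] at h
  exact le_of_mul_le_mul_right h (by positivity)

/-- `c ≥ sin K_μ / K_μ` (the tree's chord bound `cQ_le_bandNormalCoeff` at `a = b = μ`; attained at the antinodes). [folklore] -/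
theorem klfs_sinc_umklappRadius_le_bandNormalCoeff (θ : ℝ) :
    Real.sin (umklappRadius μ) / umklappRadius μ ≤ bandNormalCoeff μ θ :=
  cQ_le_bandNormalCoeff hμ₁ le_rfl hμ₂ ⟨le_rfl, le_rfl⟩ θ

end Level

end Summit.HubbardSuperconductivity.HubbardSuperconductivity.Theorems

end
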